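import Summits.ResolutionOfSingularities.ResolutionOfSingularities.Theorems.FrobeniusClosingPatchingRelPerfectDepthPhaseCCommonTracePole
import Mathlib.Algebra.BigOperators.Ring.Finset
import HarnessLib

/-!
# Crux `PatchingRelPerfect` (stmt-ResolutionOfSingularities-16161), chain W5.2 — F7(β) (β-AX) PHASE C:
# the MOVE LAWS of the letter class 𝓛 (machine check of res-L1-w52-tri-1 TRIAGE v27 Row 1 (b)/(e))

[OURS · L1 W5.2 · F7(β) (β-AX) Phase C · X3 `PhaseCTermination₂` inputs · res-L1-w52-tri-1 v27 (29c7b21aaa87533d) Row 1 «EXACT LAW for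
quasi-homogeneous germs»; strategy S1 of RULING G11-9] res-L1-w52-stub-1 g5.  Replaces the role of NO printed item; NOT a statement of the
manuscript under review (AI-written, weaker than expert review).  Ring level, ANY commutative ring, ALL exponents symbolic.

The letter-class germ at a pole (hosts `𝓐₁ = V(g)`, `𝓐₂ = V(g + φ)`, `N`-summand `n`):

  `K = (g) + (g + φ) + (n)`,  `φ = tᵃ · ψ`,  `n = tᵇ · μ`,  `ψ = ∏ᵢ (αᵢ u + βᵢ v)` (`e` linear factors: letters and diagonal forms),
  `μ = uᵖ v^q` (`f = p + q`);  `t, u, v` members, `g` the first host.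

As IDEALS `K = (g) + (φ) + (n)` (`hosts_exchange`, `…DepthPhaseCCommonTracePole`).  The laws (chart substitutions of the blow-ups):

* **Π_t** (centre the surface `V(g, t)`; admissible iff `a, b ≥ 1`): `t`-chart `K = (t) · K[a − 1, b − 1]`, `ψ, μ` unchanged (`piT_tChart`);
  `g`-chart `K = (g)` (`piT_gChart`).
* **Π_m** (centre `V(g, m)` for a letter `m` dividing `ψ` and `μ`): `m`-chart divides `ψ` and `μ` by `m`, exponents unchanged (`piM_mChart`);
  `g`-chart `(g)` (`piM_gChart`).
* **poleCons** (centre the pole `V(g, t, u, v)`): `t`-chart **`(a, b) ↦ (a + e − 1, b + f − 1)`, `ψ`, `μ` UNCHANGED** (`diagProd_scale`,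
  `poleCons_tChart`) — so `Π_t`/`poleCons` never change `ψ · μ` (tri-1 (b)); `u`-chart: the diagonal forms become `αᵢ + βᵢ v′` (units or
  NON-member letters), the new exceptional `u` carries `a + e − 1` resp. `b + f − 1` (`diagProd_uChart`, `poleCons_uChart`); `g`-chart `(g)`
  (`poleCons_gChart`).  (The `v`-chart is the `u`-chart with the letters swapped.)
* **t-axis move** (centre `V(g, u, v)`, a component when `a = 0`): `u`-chart (`axis_uChart`), `g`-chart `(g)` (`axis_gChart`).
* **line move** (centre `V(g, t, m)`, `m | μ`): `m`-chart (`lineM_mChart`), `g`-chart `(g)` (`lineM_gChart`).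

These are the bookkeeping identities behind tri-1's S1 run trees (kit j282750 / j283035) and idea-1's X3 measure memo; the Rees-chart
packaging is as in `…DepthPhaseCDetachedCylinder` §2 (`map_sup₃` + `reesChartBase_apply_eq_mul_chartGen`), shown here for Π_t
(`map_piT_one`, `map_piT_zero`).  What is NOT here: END tests (they are rank statements on the letters, see the C1/C2′ files), the
`t`-chart of the line move (no clean scaling of `ψ`), anything outside 𝓛 (tacnode factors, tri-1 (f)).

## References
* The Stacks Project, Tags 0804, 0BIQ (affine blow-up algebras and their charts). [StacksProject]
* J. Kollár, *Lectures on Resolution of Singularities* (2007), (3.111) Step 3 (monomial bookkeeping). [Kollar2007]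
-/

-- `Summit.<Summit>.<Sub>.Theorems` with `Sub = Summit` (single-conjunct summit, D-0017)
set_option linter.dupNamespace false

noncomputable section

open Literature.AlgebraicGeometry.Resolution
open scoped BigOperators

namespace Summit.ResolutionOfSingularities.ResolutionOfSingularities.Theorems

universe u

namespace DepthPhaseC

/-- The letter-class germ `K = (g) + (g + φ) + (n)`. -/
local notation3 "Kl[" g "," φ "," n "]" => (Ideal.span {g} ⊔ Ideal.span {g + φ} ⊔ Ideal.span {n})

section Algebra

variable {A : Type u} [CommRing A]

/-- **The germ as an ideal**: `(g) + (g + φ) + (n) = (g) + (φ) + (n)`. [folklore] -/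
theorem germ_eq (g φ n : A) : Kl[g, φ, n] = Ideal.span {g} ⊔ Ideal.span {φ} ⊔ Ideal.span {n} :=
  hosts_exchange g φ n

/-- Factoring a common letter out of the germ: `(c g′) + (c g′ + c φ′) + (c n′) = (c) · ((g′) + (g′ + φ′) + (n′))`. [folklore] -/
theorem germ_factor (c g' φ' n' : A) : Kl[c * g', c * φ', c * n'] = Ideal.span {c} * Kl[g', φ', n'] := by
  rw [span_singleton_mul_sup₃, mul_add]

/-- A germ whose first host letter is the factored letter is that letter: `(c) + (c + c φ′) + (c n′) = (c)`. [folklore] -/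
theorem germ_eq_span_of_dvd (c φ' n' : A) : Kl[c, c * φ', c * n'] = Ideal.span {c} := by
  refine le_antisymm (sup_le (sup_le le_rfl ?_) ?_) (le_sup_of_le_left le_sup_left) <;>
    rw [Ideal.span_singleton_le_iff_mem]
  · exact Ideal.mem_span_singleton.mpr ⟨1 + φ', by ring⟩
  · exact Ideal.mem_span_singleton.mpr ⟨n', by ring⟩

/-! ### The diagonal product `ψ = ∏ (αᵢ u + βᵢ v)` under the chart substitutions -/

/-- **Scaling**: `ψ(t u′, t v′) = tᵉ · ψ(u′, v′)`. [folklore] -/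
theorem diagProd_scale {e : ℕ} (α β : Fin e → A) (t u' v' : A) :
    ∏ i, (α i * (t * u') + β i * (t * v')) = t ^ e * ∏ i, (α i * u' + β i * v') := by
  rw [show t ^ e = ∏ _i : Fin e, t by rw [Finset.prod_const, Finset.card_univ, Fintype.card_fin], ← Finset.prod_mul_distrib]
  exact Finset.prod_congr rfl fun i _ => by ring

/-- **`u`-chart of the pole blow-up**: `ψ(u, u v′) = uᵉ · ∏ (αᵢ + βᵢ v′)` — the diagonal forms become the non-member letters
`αᵢ + βᵢ v′`. [folklore] -/
theorem diagProd_uChart {e : ℕ} (α β : Fin e → A) (u v' : A) :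
    ∏ i, (α i * u + β i * (u * v')) = u ^ e * ∏ i, (α i + β i * v') := by
  rw [show u ^ e = ∏ _i : Fin e, u by rw [Finset.prod_const, Finset.card_univ, Fintype.card_fin], ← Finset.prod_mul_distrib]
  exact Finset.prod_congr rfl fun i _ => by ring

/-! ### Π_t — the surface component `V(g, t)` -/

/-- **Π_t, `t`-chart** (`g = t g′`): `(a, b) ↦ (a − 1, b − 1)`, `ψ, μ` unchanged. [folklore] -/
theorem piT_tChart (g' ψ μ t : A) (a b : ℕ) :
    Kl[t * g', t ^ (a + 1) * ψ, t ^ (b + 1) * μ] = Ideal.span {t} * Kl[g', t ^ a * ψ, t ^ b * μ] := by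
  rw [show t ^ (a + 1) * ψ = t * (t ^ a * ψ) by ring, show t ^ (b + 1) * μ = t * (t ^ b * μ) by ring, germ_factor]

/-- **Π_t, `g`-chart** (`t = g t′`): the germ is `(g)`. [folklore] -/
theorem piT_gChart (ψ μ t' g : A) (a b : ℕ) : Kl[g, (g * t') ^ (a + 1) * ψ, (g * t') ^ (b + 1) * μ] = Ideal.span {g} := by
  rw [show (g * t') ^ (a + 1) * ψ = g * (g ^ a * t' ^ (a + 1) * ψ) by ring,
    show (g * t') ^ (b + 1) * μ = g * (g ^ b * t' ^ (b + 1) * μ) by ring, germ_eq_span_of_dvd]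

/-! ### Π_m — the surface `V(g, m)` for a letter `m` dividing `ψ` and `μ` -/

/-- **Π_m, `m`-chart** (`g = m g′`; `ψ = m ψ₁`, `μ = m μ₁`): `ψ, μ` lose the factor `m`, the `t`-exponents are unchanged. [folklore] -/
theorem piM_mChart (g' ψ₁ μ₁ ta tb m : A) :
    Kl[m * g', ta * (m * ψ₁), tb * (m * μ₁)] = Ideal.span {m} * Kl[g', ta * ψ₁, tb * μ₁] := by
  rw [show ta * (m * ψ₁) = m * (ta * ψ₁) by ring, show tb * (m * μ₁) = m * (tb * μ₁) by ring, germ_factor]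

/-- **Π_m, `g`-chart** (`m = g m′`): the germ is `(g)`. [folklore] -/
theorem piM_gChart (ψ₁ μ₁ ta tb m' g : A) : Kl[g, ta * (g * m' * ψ₁), tb * (g * m' * μ₁)] = Ideal.span {g} := by
  rw [show ta * (g * m' * ψ₁) = g * (ta * m' * ψ₁) by ring, show tb * (g * m' * μ₁) = g * (tb * m' * μ₁) by ring,
    germ_eq_span_of_dvd]

/-! ### poleCons — the pole `V(g, t, u, v)` -/

/-- **poleCons, `t`-chart** (`g = t g′`, `u = t u′`, `v = t v′`): **`(a, b) ↦ (a + e − 1, b + f − 1)`, `ψ, μ` UNCHANGED** (`f = p + q`;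
admissible for `a + e ≥ 1`, `b + f ≥ 1`). [folklore] -/
theorem poleCons_tChart {e : ℕ} (α β : Fin e → A) (g' t u' v' : A) {a b p q : ℕ} (hae : 1 ≤ a + e) (hbf : 1 ≤ b + (p + q)) :
    Kl[t * g', t ^ a * ∏ i, (α i * (t * u') + β i * (t * v')), t ^ b * ((t * u') ^ p * (t * v') ^ q)] =
      Ideal.span {t} * Kl[g', t ^ (a + e - 1) * ∏ i, (α i * u' + β i * v'), t ^ (b + (p + q) - 1) * (u' ^ p * v' ^ q)] := by
  obtain ⟨c, hc⟩ := Nat.exists_eq_add_of_le hae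
  obtain ⟨d, hd⟩ := Nat.exists_eq_add_of_le hbf
  rw [diagProd_scale, hc, hd, Nat.add_sub_cancel_left, Nat.add_sub_cancel_left,
    show t ^ a * (t ^ e * ∏ i, (α i * u' + β i * v')) = t * (t ^ c * ∏ i, (α i * u' + β i * v')) by
      rw [← mul_assoc, ← pow_add, hc, pow_add, pow_one, mul_assoc],
    show t ^ b * ((t * u') ^ p * (t * v') ^ q) = t * (t ^ d * (u' ^ p * v' ^ q)) by
      rw [mul_pow, mul_pow, show t ^ b * (t ^ p * u' ^ p * (t ^ q * v' ^ q)) = t ^ (b + (p + q)) * (u' ^ p * v' ^ q) by ring, hd]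
      ring,
    germ_factor]

/-- **poleCons, `u`-chart** (`g = u g′`, `t = u t′`, `v = u v′`): the new exceptional `u` carries `a + e − 1` resp. `b + f − 1`, the old
`t` keeps `a`, `b`, the diagonal forms become `αᵢ + βᵢ v′`. [folklore] -/
theorem poleCons_uChart {e : ℕ} (α β : Fin e → A) (g' t' u v' : A) {a b p q : ℕ} (hae : 1 ≤ a + e) (hbf : 1 ≤ b + (p + q)) :
    Kl[u * g', (u * t') ^ a * ∏ i, (α i * u + β i * (u * v')), (u * t') ^ b * (u ^ p * (u * v') ^ q)] =
      Ideal.span {u} *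
        Kl[g', u ^ (a + e - 1) * t' ^ a * ∏ i, (α i + β i * v'), u ^ (b + (p + q) - 1) * t' ^ b * v' ^ q] := by
  obtain ⟨c, hc⟩ := Nat.exists_eq_add_of_le hae
  obtain ⟨d, hd⟩ := Nat.exists_eq_add_of_le hbf
  rw [diagProd_uChart, hc, hd, Nat.add_sub_cancel_left, Nat.add_sub_cancel_left,
    show (u * t') ^ a * (u ^ e * ∏ i, (α i + β i * v')) = u * (u ^ c * t' ^ a * ∏ i, (α i + β i * v')) by
      rw [mul_pow, show u ^ a * t' ^ a * (u ^ e * ∏ i, (α i + β i * v')) =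
        u ^ (a + e) * (t' ^ a * ∏ i, (α i + β i * v')) by ring, hc]
      ring,
    show (u * t') ^ b * (u ^ p * (u * v') ^ q) = u * (u ^ d * t' ^ b * v' ^ q) by
      rw [mul_pow, mul_pow, show u ^ b * t' ^ b * (u ^ p * (u ^ q * v' ^ q)) = u ^ (b + (p + q)) * (t' ^ b * v' ^ q) by ring, hd]
      ring,
    germ_factor]

/-- **poleCons, `g`-chart** (`t = g t′`, `u = g u′`, `v = g v′`): the germ is `(g)` (for `a + e ≥ 1`, `b + f ≥ 1`). [folklore] -/
theorem poleCons_gChart {e : ℕ} (α β : Fin e → A) (g t' u' v' : A) {a b p q : ℕ} (hae : 1 ≤ a + e) (hbf : 1 ≤ b + (p + q)) :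
    Kl[g, (g * t') ^ a * ∏ i, (α i * (g * u') + β i * (g * v')), (g * t') ^ b * ((g * u') ^ p * (g * v') ^ q)] =
      Ideal.span {g} := by
  obtain ⟨c, hc⟩ := Nat.exists_eq_add_of_le hae
  obtain ⟨d, hd⟩ := Nat.exists_eq_add_of_le hbf
  rw [diagProd_scale,
    show (g * t') ^ a * (g ^ e * ∏ i, (α i * u' + β i * v')) = g * (g ^ c * t' ^ a * ∏ i, (α i * u' + β i * v')) by
      rw [mul_pow, show g ^ a * t' ^ a * (g ^ e * ∏ i, (α i * u' + β i * v')) =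
        g ^ (a + e) * (t' ^ a * ∏ i, (α i * u' + β i * v')) by ring, hc]
      ring,
    show (g * t') ^ b * ((g * u') ^ p * (g * v') ^ q) = g * (g ^ d * t' ^ b * (u' ^ p * v' ^ q)) by
      rw [mul_pow, mul_pow, mul_pow,
        show g ^ b * t' ^ b * (g ^ p * u' ^ p * (g ^ q * v' ^ q)) = g ^ (b + (p + q)) * (t' ^ b * (u' ^ p * v' ^ q)) by ring, hd]
      ring,
    germ_eq_span_of_dvd]

/-- **STUCK poles (tri-1 v27 Row 1 (e) / L4): `a = 0`, `μ = 1`, `ψ` diagonal-only.**  There S1 prescribes poleCons, and on the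
`t`-chart the `N`-exponent DROPS, `b + 1 ↦ b` (while `ψ` is unchanged and `φ` acquires `tᵉ⁻¹`): poleCons does NOT regress at a stuck
pole. [folklore] -/
theorem poleCons_tChart_stuck {e : ℕ} (α β : Fin e → A) (g' t u' v' : A) (b : ℕ) (he : 1 ≤ e) :
    Kl[t * g', ∏ i, (α i * (t * u') + β i * (t * v')), t ^ (b + 1)] =
      Ideal.span {t} * Kl[g', t ^ (e - 1) * ∏ i, (α i * u' + β i * v'), t ^ b] := by
  have hte : t ^ e = t * t ^ (e - 1) := by rw [← pow_succ', Nat.sub_add_cancel he]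
  rw [diagProd_scale, hte, mul_assoc, pow_succ', germ_factor]

/-- **STUCK poles, `u`-chart**: the new exceptional `u` carries `e − 1` on the host side and `b` on the `N`-side (`t′` keeps `b + 1`), and
the diagonal forms have become the non-member letters `αᵢ + βᵢ v′`. [folklore] -/
theorem poleCons_uChart_stuck {e : ℕ} (α β : Fin e → A) (g' t' u v' : A) (b : ℕ) (he : 1 ≤ e) :
    Kl[u * g', ∏ i, (α i * u + β i * (u * v')), (u * t') ^ (b + 1)] =
      Ideal.span {u} * Kl[g', u ^ (e - 1) * ∏ i, (α i + β i * v'), u ^ b * t' ^ (b + 1)] := by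
  have hue : u ^ e = u * u ^ (e - 1) := by rw [← pow_succ', Nat.sub_add_cancel he]
  rw [diagProd_uChart, hue, mul_assoc, show (u * t') ^ (b + 1) = u * (u ^ b * t' ^ (b + 1)) by ring, germ_factor]

/-! ### The t-axis `V(g, u, v)` (a component when `a = 0`) and the line `V(g, t, m)` -/

/-- **t-axis move, `u`-chart** (`g = u g′`, `v = u v′`; `e ≥ 1`, `f ≥ 1`): `u` carries `e − 1` resp. `f − 1`, `t`-exponents unchanged.
[folklore] -/
theorem axis_uChart {e : ℕ} (α β : Fin e → A) (g' ta tb u v' : A) {p q : ℕ} (he : 1 ≤ e) (hf : 1 ≤ p + q) :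
    Kl[u * g', ta * ∏ i, (α i * u + β i * (u * v')), tb * (u ^ p * (u * v') ^ q)] =
      Ideal.span {u} * Kl[g', u ^ (e - 1) * ta * ∏ i, (α i + β i * v'), u ^ (p + q - 1) * tb * v' ^ q] := by
  obtain ⟨d, hd⟩ := Nat.exists_eq_add_of_le hf
  have hue : u ^ e = u * u ^ (e - 1) := by rw [← pow_succ', Nat.sub_add_cancel he]
  rw [diagProd_uChart, hue, hd, Nat.add_sub_cancel_left,
    show ta * (u * u ^ (e - 1) * ∏ i, (α i + β i * v')) = u * (u ^ (e - 1) * ta * ∏ i, (α i + β i * v')) by ring,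
    show tb * (u ^ p * (u * v') ^ q) = u * (u ^ d * tb * v' ^ q) by
      rw [mul_pow, show tb * (u ^ p * (u ^ q * v' ^ q)) = u ^ (p + q) * (tb * v' ^ q) by ring, hd]; ring,
    germ_factor]

/-- **t-axis move, `g`-chart** (`u = g u′`, `v = g v′`; `e, f ≥ 1`): the germ is `(g)`. [folklore] -/
theorem axis_gChart {e : ℕ} (α β : Fin e → A) (g ta tb u' v' : A) {p q : ℕ} (he : 1 ≤ e) (hf : 1 ≤ p + q) :
    Kl[g, ta * ∏ i, (α i * (g * u') + β i * (g * v')), tb * ((g * u') ^ p * (g * v') ^ q)] = Ideal.span {g} := by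
  obtain ⟨d, hd⟩ := Nat.exists_eq_add_of_le hf
  have hge : g ^ e = g * g ^ (e - 1) := by rw [← pow_succ', Nat.sub_add_cancel he]
  rw [diagProd_scale, hge,
    show ta * (g * g ^ (e - 1) * ∏ i, (α i * u' + β i * v')) = g * (ta * g ^ (e - 1) * ∏ i, (α i * u' + β i * v')) by ring,
    show tb * ((g * u') ^ p * (g * v') ^ q) = g * (g ^ d * tb * (u' ^ p * v' ^ q)) by
      rw [mul_pow, mul_pow, show tb * (g ^ p * u' ^ p * (g ^ q * v' ^ q)) = g ^ (p + q) * (tb * (u' ^ p * v' ^ q)) by ring, hd]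
      ring,
    germ_eq_span_of_dvd]

/-- **Line move `V(g, t, m)`, `m`-chart** (`g = m g′`, `t = m t′`; `a ≥ 1`, `μ = m μ₁`): the new exceptional `m` carries `a − 1` resp. `b`.
[folklore] -/
theorem lineM_mChart (g' ψ μ₁ t' m : A) (a b : ℕ) :
    Kl[m * g', (m * t') ^ (a + 1) * ψ, (m * t') ^ b * (m * μ₁)] =
      Ideal.span {m} * Kl[g', m ^ a * t' ^ (a + 1) * ψ, m ^ b * t' ^ b * μ₁] := by
  rw [show (m * t') ^ (a + 1) * ψ = m * (m ^ a * t' ^ (a + 1) * ψ) by ring,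
    show (m * t') ^ b * (m * μ₁) = m * (m ^ b * t' ^ b * μ₁) by ring, germ_factor]

/-- **Line move `V(g, t, m)`, `g`-chart** (`t = g t′`, `m = g m′`; `a ≥ 1`, `μ = m μ₁`): the germ is `(g)`. [folklore] -/
theorem lineM_gChart (ψ μ₁ t' m' g : A) (a b : ℕ) :
    Kl[g, (g * t') ^ (a + 1) * ψ, (g * t') ^ b * (g * m' * μ₁)] = Ideal.span {g} := by
  rw [show (g * t') ^ (a + 1) * ψ = g * (g ^ a * t' ^ (a + 1) * ψ) by ring,
    show (g * t') ^ b * (g * m' * μ₁) = g * (g ^ b * t' ^ b * m' * μ₁) by ring, germ_eq_span_of_dvd]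

end Algebra

/-! ## Rees-chart packaging, shown for Π_t -/

section Charts

variable {R : Type u} [CommRing R] (g t ψ μ : R)

local notation3 "c₂" => (![g, t] : Fin 2 → R)

set_option maxHeartbeats 400000 in
-- instance-path defeq through `HomogeneousLocalization`'s standalone `Pow`/`Mul` (as in p508825)
/-- **Π_t, `t`-chart image**: `K · B_t = (t) · K[a − 1, b − 1](g/t)`. [cite: StacksProject, Tag 0804] -/
theorem map_piT_one (a b : ℕ) :
    (Kl[g, t ^ (a + 1) * ψ, t ^ (b + 1) * μ]).map (chartBase c₂ 1) = Ideal.span {chartBase c₂ 1 t} *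
      Kl[chartGen c₂ 1 0, chartBase c₂ 1 t ^ a * chartBase c₂ 1 ψ, chartBase c₂ 1 t ^ b * chartBase c₂ 1 μ] := by
  have cb : chartBase c₂ 1 g = chartBase c₂ 1 t * chartGen c₂ 1 0 := reesChartBase_apply_eq_mul_chartGen c₂ 1 0
  rw [map_sup₃, map_add, map_mul, map_mul, map_pow, map_pow, cb]
  exact piT_tChart _ _ _ _ a b

set_option maxHeartbeats 400000 in
-- instance-path defeq through `HomogeneousLocalization`'s standalone `Pow`/`Mul` (as in p508825)
/-- **Π_t, `g`-chart image**: `K · B_g = (g)`. [cite: StacksProject, Tag 0804] -/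
theorem map_piT_zero (a b : ℕ) :
    (Kl[g, t ^ (a + 1) * ψ, t ^ (b + 1) * μ]).map (chartBase c₂ 0) = Ideal.span {chartBase c₂ 0 g} := by
  have cb : chartBase c₂ 0 t = chartBase c₂ 0 g * chartGen c₂ 0 1 := reesChartBase_apply_eq_mul_chartGen c₂ 0 1
  rw [map_sup₃, map_add, map_mul, map_mul, map_pow, map_pow, cb]
  exact piT_gChart _ _ _ _ a b

end Charts

end DepthPhaseC

end Summit.ResolutionOfSingularities.ResolutionOfSingularities.Theorems

end
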